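import Literature.NumberTheory.EllipticCurves.FormalGroupInfiniteHeightProofs
import Literature.NumberTheory.EllipticCurves.ManinConstantMultiplicativePrimesProofs
import Literature.NumberTheory.EllipticCurves.RootNumberTwistProofs
import Literature.NumberTheory.EllipticCurves.CongruentNumberCurveMinimalAtTwo
import Literature.NumberTheory.EllipticCurves.PAdicHeightsTateValuationProofs
import HarnessLib

/-!
# An additive prime `p ≥ 5`: the short model reduces to `y² = x³`, `aₙ = 0` for `p ∣ n`, and the
# twist over `ℚ_p(p^{1/12})` with good or multiplicative reduction (proofs only)

Topic `NumberTheory/EllipticCurves` (theorems only; no definition, no named fact). The arithmetic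
inputs at a prime `p ≥ 5` of ADDITIVE reduction (`p ∣ Δ_min`, `p ∣ c₄`; Silverman VII.5.1(c)) of the
finite-height route to the named fact
`Literature.NumberTheory.EllipticCurves.edixhoven_int_of_neronLattice_eq_smul_periodLattice`
(Edixhoven 1991, Prop. 2: the Manin constant is an integer; `NeronIsogenyScaling.lean`,
`ManinConstantGoodPrimesProofs`, `ManinConstantMultiplicativePrimesProofs`):

* `lFunction_eq_zero_of_dvd_of_dvd`: `aₙ(W) = 0` for `p ∣ n` (the Euler factor at an additive
  prime is `1`), so `Σ aₙXⁿ/n ∈ ℤ_p⟦X⟧` (`norm_coeff_lSeriesLog_le_one_of_dvd_of_dvd`);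
* `formalMul_prime_map_toZMod_eq_zero_of_isShortNF`: a `p`-integral short model `y² = x³ + Ax + B`
  with `p ∣ c₄`, `p ∣ Δ` has `p ∣ A`, `p ∣ B`, i.e. reduces to the cuspidal cubic `y² = x³`, whose
  formal group is `𝔾̂ₐ`: `[p]˜ = 0` — INFINITE height (whence `log`, `exp` are `p`-integral,
  `FormalGroupInfiniteHeightProofs`);
* `not_pow_dvd_of_isMinimal`: minimality at `p` of the curve forbids `p⁴ ∣ A ∧ p⁶ ∣ B`
  (Silverman VII.1, Remark 1.1: for `p ≥ 5` an integral equation with `v(c₄) ≥ 4`, `v(c₆) ≥ 6` is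
  not minimal);
* `exists_semistableTwistData`: **the semistable model over `ℚ_p(p^{1/12})`, as data over `ℤ_p`.**
  From `¬(p⁴ ∣ A ∧ p⁶ ∣ B)` there are `k < 12`, `i, j` with `4k ≤ 12i`, `6k ≤ 12j`, and
  `A = pⁱA₁`, `B = pʲB₁` such that the curve `Ṽ₁ : y² = x³ + [3i = k]A₁ x + [2j = k]B₁` over `𝔽_p`
  has `[p]˜ ≠ 0` (finite height). Over `O = ℤ_p[π]`, `π¹² = p`, the `ℤ_p[π]`-integral twist
  `y² = x³ + π^{12i−4k}A₁x + π^{12j−6k}B₁` of `y² = x³ + Ax + B` by `u = πᵏ` reduces modulo `π`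
  to `Ṽ₁`: it has good reduction (`k = v(Δ) ∈ {2,3,4,6,8,9,10}`: potentially good reduction,
  Silverman VII.5.4–5.5 / Table 4.1) or multiplicative reduction (`k = 6`, `v(c₄) = 2`,
  `v(c₆) = 3`: potentially multiplicative reduction `I_n^*`). This is the case `p ≥ 5` of the
  semistable reduction theorem made explicit by Tate's algorithm-free valuations of `c₄, c₆, Δ`;
  the finite height of `Ṽ₁` is `FormalGroupFiniteHeightProofs` (elliptic) or
  `ManinConstantMultiplicativePrimesProofs.formalMul_prime_map_toZMod_ne_zero_of_nodal` (node).

## References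

* J. H. Silverman, *The Arithmetic of Elliptic Curves*, 2nd ed. (2009), VII.1 Remark 1.1, VII.5
  Prop. 5.1(c), Prop. 5.4(c), Prop. 5.5, App. C §16 (`L_v(T) = 1` at an additive place).
  [SilvermanAEC2009]
* J.-P. Serre, J. Tate, *Good reduction of abelian varieties*, Ann. of Math. 88 (1968), §2
  (potential good reduction; for `p ≥ 5` the semistable reduction of an elliptic curve is attained
  over an extension of degree dividing `12`). [folklore]
* B. Edixhoven, *On the Manin constants of modular elliptic curves* (1991), Prop. 2.
  [EdixhovenManin1991]
-/

noncomputable section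

open scoped Classical

namespace WeierstrassCurve

open PowerSeries Literature.NumberTheory.EllipticCurves Literature.RingTheory.FormalGroups
open IsDedekindDomain NumberField Rat.HeightOneSpectrum Literature.NumberTheory.EllipticCurves.ModularForms

/-! ### `aₙ = 0` for `p ∣ n` at an additive prime -/

section LFunction

variable (W : WeierstrassCurve ℚ) [W.IsElliptic] [W.IsGloballyMinimal]

/-- **Additive reduction from `p ∣ Δ_min`, `p ∣ c₄`** (Silverman, *AEC*, VII.5.1(c)) for a globally
minimal `W`, at the place `v` over `p`. [cite: SilvermanAEC2009, VII.5 Prop. 5.1(c)] -/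
theorem hasAdditiveReductionAt_of_dvd_of_dvd (v : HeightOneSpectrum (𝓞 ℚ))
    (hΔ : ((primesEquiv v : ℕ) : ℤ) ∣ minimalDiscriminantInt W)
    (hc₄ : ((primesEquiv v : ℕ) : ℤ) ∣ (integralModelInt W).c₄) : W.HasAdditiveReductionAt v := by
  haveI : Fact (primesEquiv v : ℕ).Prime := ⟨(primesEquiv v).2⟩
  have hmin : W.IsMinimalAt v := IsGloballyMinimal.isMinimal (W := W) v
  have hc : W.c₄ = ((integralModelInt W).c₄ : ℚ) := by
    conv_lhs => rw [← map_integralModelInt W]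
    rw [map_c₄, eq_intCast]
  refine hasAdditiveReductionAt_of_isMinimalAt v W hmin ?_ ?_ W.isUnit_Δ.ne_zero
  · rw [← cast_minimalDiscriminantInt, (valuation_equiv_padicValuation v).lt_one_iff_lt_one,
      Rat.padicValuation_cast, Int.padicValuation_lt_one_iff]
    exact hΔ
  · rw [hc, (valuation_equiv_padicValuation v).lt_one_iff_lt_one, Rat.padicValuation_cast,
      Int.padicValuation_lt_one_iff]
    exact hc₄

/-- **`aₙ(W) = 0` whenever `p ∣ n`, at an additive prime `p ∣ Δ_min`, `p ∣ c₄`** (the Euler factor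
at `p` is `1`). [cite: SilvermanAEC2009, §C.16 (definition of L_v(T)), PDF p. 390] -/
theorem lFunction_eq_zero_of_dvd_of_dvd (p : ℕ) [hp : Fact p.Prime]
    (hΔ : (p : ℤ) ∣ minimalDiscriminantInt W) (hc₄ : (p : ℤ) ∣ (integralModelInt W).c₄) {n : ℕ}
    (hn : p ∣ n) : W.LFunction n = 0 := by
  obtain ⟨v, rfl⟩ : ∃ v : HeightOneSpectrum (𝓞 ℚ), (primesEquiv v : ℕ) = p :=
    ⟨primesEquiv.symm ⟨p, hp.out⟩, by rw [Equiv.apply_symm_apply]⟩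
  exact W.LFunction_apply_eq_zero_of_hasAdditiveReductionAt rfl
    (W.hasAdditiveReductionAt_of_dvd_of_dvd v hΔ hc₄) hn

/-- **`ℓ = Σ aₙ(W) Xⁿ/n ∈ ℤ_p⟦X⟧` at an additive prime**: `aₙ = 0` for `p ∣ n` and `‖aₙ/n‖ ≤ 1`
for `p ∤ n`. [cite: SilvermanAEC2009, §C.16 (definition of L_v(T)), PDF p. 390] -/
theorem norm_coeff_lSeriesLog_le_one_of_dvd_of_dvd (p : ℕ) [hp : Fact p.Prime]
    (hΔ : (p : ℤ) ∣ minimalDiscriminantInt W) (hc₄ : (p : ℤ) ∣ (integralModelInt W).c₄) (k : ℕ) :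
    ‖coeff k (PowerSeries.mk fun k ↦ ((W.LFunction k : ℤ) : ℚ_[p]) / k)‖ ≤ 1 := by
  rw [coeff_mk]
  by_cases hk : p ∣ k
  · rw [W.lFunction_eq_zero_of_dvd_of_dvd p hΔ hc₄ hk, Int.cast_zero, zero_div, norm_zero]
    exact zero_le_one
  · have hk1 : ‖(k : ℚ_[p])‖ = 1 := by
      rw [Padic.norm_natCast_eq_one_iff]
      exact (Nat.Prime.coprime_iff_not_dvd hp.out).mpr hk
    rw [norm_div, hk1, div_one]
    exact Padic.norm_int_le_one _

end LFunction

/-! ### Finite height criteria for curves over `ℤ_p` -/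

section FiniteHeight

variable {p : ℕ} [hp : Fact p.Prime] (V : WeierstrassCurve ℤ_[p])

/-- **`[p]˜ ≠ 0` when the reduction is elliptic** (`Δ̃ ≠ 0`, `p` odd). [cite: SilvermanAEC2009, Thm. V.2.3.1(b)] -/
theorem formalMul_prime_map_toZMod_ne_zero_of_Δ_ne_zero (hp2 : p ≠ 2)
    (hΔ : (V.map PadicInt.toZMod).Δ ≠ 0) : (V.map PadicInt.toZMod).formalMul p ≠ 0 := by
  haveI : (V.map PadicInt.toZMod).IsElliptic := ⟨isUnit_iff_ne_zero.mpr hΔ⟩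
  haveI : (V.map PadicInt.Coe.ringHom).IsElliptic := by
    refine ⟨isUnit_iff_ne_zero.mpr ?_⟩
    rw [map_Δ]
    intro h
    apply hΔ
    rw [map_Δ, show V.Δ = 0 from PadicInt.coe_eq_zero.mp h, map_zero]
  exact V.formalMul_prime_map_toZMod_ne_zero hp2

/-- **`[p]˜ ≠ 0` when `c̃₄ ≠ 0`** (the reduction is elliptic or a node, `p` odd).
[cite: SilvermanAEC2009, IV.7 and VII.5] -/
theorem formalMul_prime_map_toZMod_ne_zero_of_c₄_ne_zero (hp2 : p ≠ 2)
    (hc₄ : (V.map PadicInt.toZMod).c₄ ≠ 0) : (V.map PadicInt.toZMod).formalMul p ≠ 0 := by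
  by_cases hΔ : (V.map PadicInt.toZMod).Δ = 0
  · exact V.formalMul_prime_map_toZMod_ne_zero_of_nodal hΔ hc₄
  · exact V.formalMul_prime_map_toZMod_ne_zero_of_Δ_ne_zero hp2 hΔ

/-- The reduction of a short curve `(0,0,0,a₄,a₆)` over `ℤ_p`, coefficientwise. [folklore] -/
theorem map_toZMod_short (a₄ a₆ : ℤ_[p]) :
    (({ a₁ := 0, a₂ := 0, a₃ := 0, a₄ := a₄, a₆ := a₆ } : WeierstrassCurve ℤ_[p]).map
        PadicInt.toZMod) =
      { a₁ := 0, a₂ := 0, a₃ := 0, a₄ := PadicInt.toZMod a₄, a₆ := PadicInt.toZMod a₆ } := by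
  ext <;> simp [WeierstrassCurve.map]

/-- **Finite height of `y² = x³ + A₁x` with `A₁ ∈ ℤ_pˣ`** (`Δ̃ = −64Ã₁³ ≠ 0`, `p ≥ 5`).
[cite: SilvermanAEC2009, Thm. V.2.3.1(b)] -/
theorem formalMul_prime_map_toZMod_ne_zero_short_left (hp5 : 5 ≤ p) {A₁ : ℤ_[p]}
    (hA : IsUnit A₁) :
    (({ a₁ := 0, a₂ := 0, a₃ := 0, a₄ := A₁, a₆ := 0 } : WeierstrassCurve ℤ_[p]).map
        PadicInt.toZMod).formalMul p ≠ 0 := by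
  have hp2 : p ≠ 2 := by omega
  refine formalMul_prime_map_toZMod_ne_zero_of_Δ_ne_zero _ hp2 ?_
  rw [map_toZMod_short, map_zero]
  haveI : ({ a₁ := 0, a₂ := 0, a₃ := 0, a₄ := PadicInt.toZMod A₁, a₆ := 0 } :
      WeierstrassCurve (ZMod p)).IsShortNF := ⟨rfl, rfl, rfl⟩
  rw [Δ_of_isShortNF]
  simp only
  have h2 : (2 : ZMod p) ≠ 0 := by
    rw [show (2 : ZMod p) = ((2 : ℕ) : ZMod p) by norm_cast, Ne, ZMod.natCast_eq_zero_iff]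
    intro h
    have := Nat.le_of_dvd (by norm_num) h
    omega
  have hA' : (PadicInt.toZMod A₁) ≠ 0 := (hA.map _).ne_zero
  rw [show (-16 : ZMod p) * (4 * PadicInt.toZMod A₁ ^ 3 + 27 * 0 ^ 2) =
      -(2 ^ 6 * PadicInt.toZMod A₁ ^ 3) by ring, neg_ne_zero]
  exact mul_ne_zero (pow_ne_zero _ h2) (pow_ne_zero _ hA')

/-- **Finite height of `y² = x³ + B₁` with `B₁ ∈ ℤ_pˣ`** (`Δ̃ = −432B̃₁² ≠ 0`, `p ≥ 5`).
[cite: SilvermanAEC2009, Thm. V.2.3.1(b)] -/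
theorem formalMul_prime_map_toZMod_ne_zero_short_right (hp5 : 5 ≤ p) {B₁ : ℤ_[p]}
    (hB : IsUnit B₁) :
    (({ a₁ := 0, a₂ := 0, a₃ := 0, a₄ := 0, a₆ := B₁ } : WeierstrassCurve ℤ_[p]).map
        PadicInt.toZMod).formalMul p ≠ 0 := by
  have hp2 : p ≠ 2 := by omega
  refine formalMul_prime_map_toZMod_ne_zero_of_Δ_ne_zero _ hp2 ?_
  rw [map_toZMod_short, map_zero]
  haveI : ({ a₁ := 0, a₂ := 0, a₃ := 0, a₄ := 0, a₆ := PadicInt.toZMod B₁ } :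
      WeierstrassCurve (ZMod p)).IsShortNF := ⟨rfl, rfl, rfl⟩
  rw [Δ_of_isShortNF]
  simp only
  have h2 : (2 : ZMod p) ≠ 0 := by
    rw [show (2 : ZMod p) = ((2 : ℕ) : ZMod p) by norm_cast, Ne, ZMod.natCast_eq_zero_iff]
    intro h
    have := Nat.le_of_dvd (by norm_num) h
    omega
  have h3 : (3 : ZMod p) ≠ 0 := by
    rw [show (3 : ZMod p) = ((3 : ℕ) : ZMod p) by norm_cast, Ne, ZMod.natCast_eq_zero_iff]
    intro h
    have := Nat.le_of_dvd (by norm_num) h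
    omega
  have hB' : (PadicInt.toZMod B₁) ≠ 0 := (hB.map _).ne_zero
  rw [show (-16 : ZMod p) * (4 * 0 ^ 3 + 27 * PadicInt.toZMod B₁ ^ 2) =
      -(2 ^ 4 * 3 ^ 3 * PadicInt.toZMod B₁ ^ 2) by ring, neg_ne_zero]
  exact mul_ne_zero (mul_ne_zero (pow_ne_zero _ h2) (pow_ne_zero _ h3)) (pow_ne_zero _ hB')

/-- **Finite height of `y² = x³ + A₁x + B₁` with `A₁ ∈ ℤ_pˣ`** (`c̃₄ = −48Ã₁ ≠ 0`: the reduction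
is elliptic or a node, `p ≥ 5`). [cite: SilvermanAEC2009, IV.7 and VII.5] -/
theorem formalMul_prime_map_toZMod_ne_zero_short_of_isUnit (hp5 : 5 ≤ p) {A₁ : ℤ_[p]} (B₁ : ℤ_[p])
    (hA : IsUnit A₁) :
    (({ a₁ := 0, a₂ := 0, a₃ := 0, a₄ := A₁, a₆ := B₁ } : WeierstrassCurve ℤ_[p]).map
        PadicInt.toZMod).formalMul p ≠ 0 := by
  have hp2 : p ≠ 2 := by omega
  refine formalMul_prime_map_toZMod_ne_zero_of_c₄_ne_zero _ hp2 ?_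
  rw [map_toZMod_short]
  haveI : ({ a₁ := 0, a₂ := 0, a₃ := 0, a₄ := PadicInt.toZMod A₁, a₆ := PadicInt.toZMod B₁ } :
      WeierstrassCurve (ZMod p)).IsShortNF := ⟨rfl, rfl, rfl⟩
  rw [c₄_of_isShortNF]
  simp only
  have h2 : (2 : ZMod p) ≠ 0 := by
    rw [show (2 : ZMod p) = ((2 : ℕ) : ZMod p) by norm_cast, Ne, ZMod.natCast_eq_zero_iff]
    intro h
    have := Nat.le_of_dvd (by norm_num) h
    omega
  have h3 : (3 : ZMod p) ≠ 0 := by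
    rw [show (3 : ZMod p) = ((3 : ℕ) : ZMod p) by norm_cast, Ne, ZMod.natCast_eq_zero_iff]
    intro h
    have := Nat.le_of_dvd (by norm_num) h
    omega
  have hA' : (PadicInt.toZMod A₁) ≠ 0 := (hA.map _).ne_zero
  rw [show (-48 : ZMod p) * PadicInt.toZMod A₁ = -(2 ^ 4 * 3 * PadicInt.toZMod A₁) by ring,
    neg_ne_zero]
  exact mul_ne_zero (mul_ne_zero (pow_ne_zero _ h2) h3) hA'

end FiniteHeight

/-! ### Valuations in `ℤ_p` -/

section Valuation

variable {p : ℕ} [hp : Fact p.Prime]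

/-- The valuation of a unit of `ℤ_p` is `0`. [folklore] -/
theorem _root_.Literature.NumberTheory.EllipticCurves.padicInt_valuation_eq_zero_of_isUnit {x : ℤ_[p]}
    (hx : IsUnit x) : x.valuation = 0 := by
  have h1 : ‖x‖ = 1 := PadicInt.isUnit_iff.mp hx
  have hx0 : x ≠ 0 := hx.ne_zero
  rw [PadicInt.norm_eq_zpow_neg_valuation hx0] at h1
  have hp1 : (1 : ℝ) < p := by exact_mod_cast hp.out.one_lt
  have := zpow_right_injective₀ (by positivity) hp1.ne' (h1.trans (zpow_zero (p : ℝ)).symm)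
  omega

/-- `pⁿ ∣ x ↔ n ≤ v(x)` for `x ≠ 0` in `ℤ_p`. [folklore] -/
theorem _root_.Literature.NumberTheory.EllipticCurves.padicInt_pow_dvd_iff_le_valuation {x : ℤ_[p]}
    (hx : x ≠ 0) (n : ℕ) : (p : ℤ_[p]) ^ n ∣ x ↔ n ≤ x.valuation := by
  constructor
  · rintro ⟨y, rfl⟩
    have hy : y ≠ 0 := by rintro rfl; exact hx (mul_zero _)
    rw [PadicInt.valuation_p_pow_mul n y hy]
    exact Nat.le_add_right _ _
  · intro h
    refine ⟨(PadicInt.unitCoeff hx : ℤ_[p]) * (p : ℤ_[p]) ^ (x.valuation - n), ?_⟩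
    conv_lhs => rw [PadicInt.unitCoeff_spec hx]
    rw [mul_left_comm, ← pow_add, Nat.add_sub_cancel' h]

/-- `v(−x) = v(x)` in `ℤ_p`. [folklore] -/
theorem _root_.Literature.NumberTheory.EllipticCurves.padicInt_valuation_neg (x : ℤ_[p]) :
    (-x).valuation = x.valuation := by
  rcases eq_or_ne x 0 with rfl | hx
  · rw [neg_zero]
  have h := PadicInt.norm_eq_zpow_neg_valuation (neg_ne_zero.mpr hx)
  rw [norm_neg, PadicInt.norm_eq_zpow_neg_valuation hx] at h
  have hp1 : (1 : ℝ) < p := by exact_mod_cast hp.out.one_lt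
  have := zpow_right_injective₀ (by positivity) hp1.ne' h
  omega

/-- **Strict ultrametric inequality in `ℤ_p`**: `v(x + y) = v(x)` if `v(x) < v(y)`, `x ≠ 0`.
[folklore] -/
theorem _root_.Literature.NumberTheory.EllipticCurves.padicInt_valuation_add_eq_of_lt {x y : ℤ_[p]}
    (hx : x ≠ 0) (h : x.valuation < y.valuation) : (x + y).valuation = x.valuation := by
  have hp1 : (1 : ℝ) < p := by exact_mod_cast hp.out.one_lt
  have hy : y ≠ 0 := by rintro rfl; rw [PadicInt.valuation_zero] at h; omega
  have hxy : x + y ≠ 0 := by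
    intro h0
    have hx' : x = -y := eq_neg_of_add_eq_zero_left h0
    rw [hx', padicInt_valuation_neg] at h
    exact lt_irrefl _ h
  refine le_antisymm ?_ ?_
  · -- `x = (x + y) + (−y)`
    by_contra hlt
    rw [not_le] at hlt
    have h1 := PadicInt.le_valuation_add (x := x + y) (y := -y) (by rw [add_neg_cancel_right]; exact hx)
    rw [add_neg_cancel_right, padicInt_valuation_neg] at h1
    have : min (x + y).valuation y.valuation > x.valuation := lt_min hlt h
    omega
  · have h1 := PadicInt.le_valuation_add hxy
    rw [min_eq_left h.le] at h1
    exact h1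

end Valuation

/-! ### The short model at an additive prime and its twist over `ℚ_p(p^{1/12})` -/

section Additive

variable {p : ℕ} [hp : Fact p.Prime]

/-- **At an additive prime the `p`-integral short model has `p ∣ A`, `p ∣ B`**: for a short
`E₀ : y² = x³ + Ax + B` over `ℚ_p` (`p ≥ 5`) with `A, B ∈ ℤ_p`, `‖c₄‖ < 1` and `‖Δ‖ < 1` force
`‖A‖ < 1` (`c₄ = −48A`) and `‖B‖ < 1` (`432B² = −Δ − 64A³`). [cite: SilvermanAEC2009, VII.5 Prop. 5.1(c)] -/
theorem norm_a₄_lt_one_and_norm_a₆_lt_one (hp5 : 5 ≤ p) (E₀ : WeierstrassCurve ℚ_[p]) [E₀.IsShortNF]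
    (h₄ : ‖E₀.a₄‖ ≤ 1) (hc₄ : ‖E₀.c₄‖ < 1) (hΔ : ‖E₀.Δ‖ < 1) : ‖E₀.a₄‖ < 1 ∧ ‖E₀.a₆‖ < 1 := by
  have hn2 : ‖(2 : ℚ_[p])‖ = 1 := by
    rw [show (2 : ℚ_[p]) = ((2 : ℕ) : ℚ_[p]) by norm_cast, Padic.norm_natCast_eq_one_iff]
    exact ((Nat.coprime_primes Nat.prime_two hp.out).mpr (by omega)).symm
  have hn3 : ‖(3 : ℚ_[p])‖ = 1 := by
    rw [show (3 : ℚ_[p]) = ((3 : ℕ) : ℚ_[p]) by norm_cast, Padic.norm_natCast_eq_one_iff]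
    exact ((Nat.coprime_primes Nat.prime_three hp.out).mpr (by omega)).symm
  have hA : ‖E₀.a₄‖ < 1 := by
    have h := hc₄
    rw [c₄_of_isShortNF, show (-48 : ℚ_[p]) * E₀.a₄ = -(2 ^ 4 * 3 * E₀.a₄) by ring, norm_neg,
      norm_mul, norm_mul, norm_pow, hn2, hn3, one_pow, one_mul, one_mul] at h
    exact h
  refine ⟨hA, ?_⟩
  have h : (2 : ℚ_[p]) ^ 4 * 3 ^ 3 * E₀.a₆ ^ 2 = -E₀.Δ + -(2 ^ 6 * E₀.a₄ ^ 3) := by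
    rw [Δ_of_isShortNF]; ring
  have h1 : ‖E₀.a₆‖ ^ 2 < 1 := by
    calc ‖E₀.a₆‖ ^ 2 = ‖(2 : ℚ_[p]) ^ 4 * 3 ^ 3 * E₀.a₆ ^ 2‖ := by
          rw [norm_mul, norm_mul, norm_pow, norm_pow, norm_pow, hn2, hn3, one_pow, one_pow, one_mul,
            one_mul]
      _ ≤ max ‖-E₀.Δ‖ ‖-((2 : ℚ_[p]) ^ 6 * E₀.a₄ ^ 3)‖ := by
          rw [h]; exact IsUltrametricDist.norm_add_le_max _ _
      _ < 1 := by
          refine max_lt (by rwa [norm_neg]) ?_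
          rw [norm_neg, norm_mul, norm_pow, norm_pow, hn2, one_pow, one_mul]
          calc ‖E₀.a₄‖ ^ 3 ≤ ‖E₀.a₄‖ ^ 1 := pow_le_pow_of_le_one (norm_nonneg _) h₄ (by norm_num)
            _ < 1 := by rw [pow_one]; exact hA
  by_contra hcon
  rw [not_lt] at hcon
  have : (1 : ℝ) ≤ ‖E₀.a₆‖ ^ 2 := one_le_pow₀ hcon
  linarith

/-- **At an additive prime `p ≥ 5` the formal group of the short model has infinite height:
`[p]˜ = 0`** — a `ℤ_p`-model `V₀` of a short curve with `p ∣ c₄`, `p ∣ Δ` reduces to the cuspidal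
cubic `y² = x³` (`FormalGroupInfiniteHeightProofs.formalMul_eq_zero_of_a_eq_zero_of_charP`).
[cite: SilvermanAEC2009, VII.5 Prop. 5.1(c) and Prop. III.2.5] -/
theorem formalMul_prime_map_toZMod_eq_zero_of_isShortNF (hp5 : 5 ≤ p) (V₀ : WeierstrassCurve ℤ_[p])
    [(V₀.map PadicInt.Coe.ringHom).IsShortNF] (hc₄ : ‖(V₀.map PadicInt.Coe.ringHom).c₄‖ < 1)
    (hΔ : ‖(V₀.map PadicInt.Coe.ringHom).Δ‖ < 1) : (V₀.map PadicInt.toZMod).formalMul p = 0 := by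
  set E₀ := V₀.map PadicInt.Coe.ringHom with hE₀
  obtain ⟨hA, hB⟩ := norm_a₄_lt_one_and_norm_a₆_lt_one hp5 E₀
    (by rw [hE₀, map_a₄]; exact PadicInt.norm_le_one _) hc₄ hΔ
  have h₁ : V₀.a₁ = 0 := by
    have h := E₀.a₁_of_isShortNF
    rw [hE₀, map_a₁] at h
    exact PadicInt.coe_eq_zero.mp h
  have h₂ : V₀.a₂ = 0 := by
    have h := E₀.a₂_of_isShortNF
    rw [hE₀, map_a₂] at h
    exact PadicInt.coe_eq_zero.mp h
  have h₃ : V₀.a₃ = 0 := by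
    have h := E₀.a₃_of_isShortNF
    rw [hE₀, map_a₃] at h
    exact PadicInt.coe_eq_zero.mp h
  have hmem : ∀ {x : ℤ_[p]}, ‖PadicInt.Coe.ringHom x‖ < 1 → PadicInt.toZMod x = 0 := fun {x} hx ↦ by
    have hx' : x ∈ RingHom.ker (PadicInt.toZMod (p := p)) := by
      rw [PadicInt.ker_toZMod, IsLocalRing.mem_maximalIdeal, PadicInt.mem_nonunits, PadicInt.norm_def]
      exact hx
    exact hx'
  have h₄ : PadicInt.toZMod V₀.a₄ = 0 := by
    have h := hA
    rw [hE₀, map_a₄] at h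
    exact hmem h
  have h₆ : PadicInt.toZMod V₀.a₆ = 0 := by
    have h := hB
    rw [hE₀, map_a₆] at h
    exact hmem h
  refine (V₀.map PadicInt.toZMod).formalMul_eq_zero_of_a_eq_zero_of_charP p ?_ ?_ ?_ ?_ ?_
  · rw [map_a₁, h₁, map_zero]
  · rw [map_a₂, h₂, map_zero]
  · rw [map_a₃, h₃, map_zero]
  · rw [map_a₄, h₄]
  · rw [map_a₆, h₆]

/-- **Minimality at `p` forbids `p⁴ ∣ A ∧ p⁶ ∣ B`**: if `X/ℚ_p` is `ℤ_p`-minimal with `Δ ≠ 0` and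
`T • X = (0, 0, 0, A, B)` with `u(T) = 1`, `A, B ∈ ℤ_p`, then `¬(p⁴ ∣ A ∧ p⁶ ∣ B)` — otherwise
`(p, 0, 0, 0) T • X = (0, 0, 0, A/p⁴, B/p⁶)` is an integral equation with `v(Δ)` smaller by `12`.
[cite: SilvermanAEC2009, VII.1 Remark 1.1] -/
theorem not_pow_dvd_of_isMinimal (X : WeierstrassCurve ℚ_[p]) [hX : X.IsMinimal ℤ_[p]] (hΔ : X.Δ ≠ 0)
    (T : VariableChange ℚ_[p]) (hTu : T.u = 1) {A B : ℤ_[p]}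
    (hT : T • X = { a₁ := 0, a₂ := 0, a₃ := 0, a₄ := (A : ℚ_[p]), a₆ := (B : ℚ_[p]) }) :
    ¬ ((p : ℤ_[p]) ^ 4 ∣ A ∧ (p : ℤ_[p]) ^ 6 ∣ B) := by
  rintro ⟨⟨A', hA'⟩, ⟨B', hB'⟩⟩
  have hp0 : (p : ℚ_[p]) ≠ 0 := by exact_mod_cast hp.out.ne_zero
  set π : ℚ_[p]ˣ := Units.mk0 (p : ℚ_[p]) hp0 with hπ
  set C : VariableChange ℚ_[p] := ⟨π, 0, 0, 0⟩ * T with hC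
  have hCX : C • X = { a₁ := 0, a₂ := 0, a₃ := 0, a₄ := (A' : ℚ_[p]), a₆ := (B' : ℚ_[p]) } := by
    rw [hC, mul_smul, hT, smul_shortModel]
    congr 1
    · rw [hA']; push_cast; rw [hπ, Units.val_mk0]; field_simp
    · rw [hB']; push_cast; rw [hπ, Units.val_mk0]; field_simp
  have hint : (C • X).IsIntegral ℤ_[p] :=
    ⟨⟨{ a₁ := 0, a₂ := 0, a₃ := 0, a₄ := A', a₆ := B' }, by
      rw [hCX]; ext <;> simp [baseChange, WeierstrassCurve.map]⟩⟩
  have hle : Padic.mulValuation (C • X).Δ ≤ Padic.mulValuation X.Δ :=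
    ((isMinimal_iff_of_le_one_iff (padicMulValuation_le_one_iff (p := p)) X).mp hX).2 C hint
  have hCu : (C.u : ℚ_[p]) = p := by
    rw [hC, VariableChange.mul_def]
    simp [hTu, hπ]
  have hΔC : (C • X).Δ = (p : ℚ_[p])⁻¹ ^ 12 * X.Δ := by
    rw [variableChange_Δ, Units.val_inv_eq_inv_val, hCu]
  have hΔC0 : (C • X).Δ ≠ 0 := by
    rw [hΔC]; exact mul_ne_zero (pow_ne_zero _ (inv_ne_zero hp0)) hΔ
  rw [padicMulValuation_apply_of_ne_zero hΔC0, padicMulValuation_apply_of_ne_zero hΔ,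
    WithZero.exp_le_exp, neg_le_neg_iff, hΔC, Padic.valuation_mul (pow_ne_zero _ (inv_ne_zero hp0)) hΔ,
    Padic.valuation_pow, Padic.valuation_inv, Padic.valuation_p] at hle
  norm_num at hle

/-- **The semistable model over `ℚ_p(p^{1/12})` as data over `ℤ_p` (`p ≥ 5`).** For `A, B ∈ ℤ_p`,
not both zero, with `¬(p⁴ ∣ A ∧ p⁶ ∣ B)` (minimality), there are `k < 12` and `i, j` with
`4k ≤ 12i`, `6k ≤ 12j`, `A = pⁱA₁`, `B = pʲB₁`, such that the curve
`y² = x³ + [12i = 4k]A₁ x + [12j = 6k]B₁` over `𝔽_p` — the reduction modulo `π` of the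
`ℤ_p[π]`-integral twist `y² = x³ + π^{12i−4k}A₁x + π^{12j−6k}B₁` (`π¹² = p`) of `y² = x³ + Ax + B` by
`u = πᵏ` — has `[p]˜ ≠ 0`. Cases (`a = v(A)`, `b = v(B)`): `3a < 2b`: `k = 3a ≤ 9`, reduction
`y² = x³ + Ã₁x`; `2b < 3a`: `k = 2b ≤ 10`, reduction `y² = x³ + B̃₁`; `3a = 2b = 6c` (`c ≤ 1` by
minimality): `k = 6c`, reduction `y² = x³ + Ã₁x + B̃₁` with `Ã₁ ≠ 0` (potentially good reduction with
`e ∣ 12`, resp. potentially multiplicative reduction over `ℚ_p(√p)`).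
[cite: SilvermanAEC2009, VII.5 Prop. 5.4(c) and Prop. 5.5] -/
theorem exists_semistableTwistData (hp5 : 5 ≤ p) (A B : ℤ_[p]) (hAB : A ≠ 0 ∨ B ≠ 0)
    (hmin : ¬ ((p : ℤ_[p]) ^ 4 ∣ A ∧ (p : ℤ_[p]) ^ 6 ∣ B)) :
    ∃ (k i j : ℕ) (A₁ B₁ : ℤ_[p]), k < 12 ∧ 4 * k ≤ 12 * i ∧ 6 * k ≤ 12 * j ∧
      A = (p : ℤ_[p]) ^ i * A₁ ∧ B = (p : ℤ_[p]) ^ j * B₁ ∧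
      (({ a₁ := 0, a₂ := 0, a₃ := 0, a₄ := if 12 * i = 4 * k then A₁ else 0,
          a₆ := if 12 * j = 6 * k then B₁ else 0 } : WeierstrassCurve ℤ_[p]).map
        PadicInt.toZMod).formalMul p ≠ 0 := by
  by_cases hA : A = 0
  · -- `A = 0`, `B ≠ 0`, `b ≤ 5`: `k = 2b`
    have hB : B ≠ 0 := hAB.resolve_left (not_not.mpr hA)
    set b := B.valuation with hb
    have hb5 : b ≤ 5 := by
      by_contra h
      exact hmin ⟨by rw [hA]; exact dvd_zero _, (padicInt_pow_dvd_iff_le_valuation hB 6).mpr (by omega)⟩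
    refine ⟨2 * b, 2 * b, b, 0, (PadicInt.unitCoeff hB : ℤ_[p]), by omega, by omega, by omega,
      by rw [hA, mul_zero], by rw [mul_comm]; exact PadicInt.unitCoeff_spec hB, ?_⟩
    rw [ite_self, if_pos (show 12 * b = 6 * (2 * b) by omega)]
    exact formalMul_prime_map_toZMod_ne_zero_short_right hp5 (Units.isUnit _)
  by_cases hB : B = 0
  · -- `B = 0`, `a ≤ 3`: `k = 3a`
    set a := A.valuation with ha
    have ha3 : a ≤ 3 := by
      by_contra h
      exact hmin ⟨(padicInt_pow_dvd_iff_le_valuation hA 4).mpr (by omega), by rw [hB]; exact dvd_zero _⟩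
    refine ⟨3 * a, a, 3 * a, (PadicInt.unitCoeff hA : ℤ_[p]), 0, by omega, by omega, by omega,
      by rw [mul_comm]; exact PadicInt.unitCoeff_spec hA, by rw [hB, mul_zero], ?_⟩
    rw [ite_self, if_pos (show 12 * a = 4 * (3 * a) by omega)]
    exact formalMul_prime_map_toZMod_ne_zero_short_left hp5 (Units.isUnit _)
  -- `A, B ≠ 0`
  set a := A.valuation with ha
  set b := B.valuation with hb
  have hAf : A = (p : ℤ_[p]) ^ a * (PadicInt.unitCoeff hA : ℤ_[p]) := by
    rw [mul_comm]; exact PadicInt.unitCoeff_spec hA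
  have hBf : B = (p : ℤ_[p]) ^ b * (PadicInt.unitCoeff hB : ℤ_[p]) := by
    rw [mul_comm]; exact PadicInt.unitCoeff_spec hB
  have hdvd : ∀ {n m : ℕ}, n ≤ a → m ≤ b → (p : ℤ_[p]) ^ n ∣ A ∧ (p : ℤ_[p]) ^ m ∣ B := fun hn hm ↦
    ⟨(padicInt_pow_dvd_iff_le_valuation hA _).mpr hn, (padicInt_pow_dvd_iff_le_valuation hB _).mpr hm⟩
  rcases lt_trichotomy (3 * a) (2 * b) with hlt | heq | hgt
  · -- `3a < 2b`: `k = 3a`, reduction `y² = x³ + Ã₁x`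
    have ha3 : a ≤ 3 := by
      by_contra h
      exact hmin (hdvd (by omega) (by omega))
    refine ⟨3 * a, a, b, (PadicInt.unitCoeff hA : ℤ_[p]), (PadicInt.unitCoeff hB : ℤ_[p]), by omega,
      by omega, by omega, hAf, hBf, ?_⟩
    rw [if_pos (show 12 * a = 4 * (3 * a) by omega), if_neg (show ¬ 12 * b = 6 * (3 * a) by omega)]
    exact formalMul_prime_map_toZMod_ne_zero_short_left hp5 (Units.isUnit _)
  · -- `3a = 2b = 6c`, `c ≤ 1`: `k = 6c`, reduction `y² = x³ + Ã₁x + B̃₁`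
    obtain ⟨c, hc⟩ : ∃ c, a = 2 * c := ⟨a / 2, by omega⟩
    have hbc : b = 3 * c := by omega
    have hc1 : c ≤ 1 := by
      by_contra h
      exact hmin (hdvd (by omega) (by omega))
    refine ⟨6 * c, a, b, (PadicInt.unitCoeff hA : ℤ_[p]), (PadicInt.unitCoeff hB : ℤ_[p]), by omega,
      by omega, by omega, hAf, hBf, ?_⟩
    rw [if_pos (show 12 * a = 4 * (6 * c) by omega), if_pos (show 12 * b = 6 * (6 * c) by omega)]
    exact formalMul_prime_map_toZMod_ne_zero_short_of_isUnit hp5 _ (Units.isUnit _)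
  · -- `2b < 3a`: `k = 2b`, reduction `y² = x³ + B̃₁`
    have hb5 : b ≤ 5 := by
      by_contra h
      exact hmin (hdvd (by omega) (by omega))
    refine ⟨2 * b, a, b, (PadicInt.unitCoeff hA : ℤ_[p]), (PadicInt.unitCoeff hB : ℤ_[p]), by omega,
      by omega, by omega, hAf, hBf, ?_⟩
    rw [if_neg (show ¬ 12 * a = 4 * (2 * b) by omega), if_pos (show 12 * b = 6 * (2 * b) by omega)]
    exact formalMul_prime_map_toZMod_ne_zero_short_right hp5 (Units.isUnit _)

end Additive

end WeierstrassCurve
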